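import Summits.Ventures.DiscreteObjects.Hadamard.InvolutionTypeII

/-!
# Hadamard matrices of order n ≡ 4 (mod 8), n not a sum of two squares: the UNIFORM involution census (kernel)

Framing: lottery ticket; floor = certified bounds/negative ranges.

Cell pub-namedobj (venture DiscreteObjects), target (H), hadamard gen 13.  Uniform version of gen 12's `hadamard668_involution_census`
and gen 13's `hadamard668_involution_census_final`: the order `668` is replaced by the two hypotheses the proofs actually use,
`|ι| ≡ 4 (mod 8)` and `|ι|` not a sum of two squares (e.g. `|ι| = 4q` with `q ≡ 3 (mod 4)`: `668, 716, 892, …`).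

* `involution_typeII_general` (`|ι| ≡ 4 (mod 8)`): `π` a fixed-point-free involution, `κ` an involution with a fixed column ⇒
  exactly four fixed columns, signs summing to `0` (gen 12's argument: trace lemma, row-pair identity mod 4, three pairwise
  orthogonal `±1` columns of one sign would force `8 ∣ |ι|`).
* `involution_typeI_general` (`|ι| ≡ 4 (mod 8)`): a fixed row and a fixed column ⇒ `#Fix π = #Fix κ = f`, one common sign, `f`
  even, `2f ≤ |ι|`.
* **`hadamard_involution_census_uniform`** (`|ι| ≡ 4 (mod 8)`, `|ι| ≠ x² + y²`): for a signed automorphism `(π, κ, d, e)` with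
  `π² = κ² = 1`, `(π, κ) ≠ (1, 1)`: `π ≠ 1`, `κ ≠ 1`, and EITHER type I — `#Fix π = #Fix κ = f`, `8 ∣ |ι| − f` (so `f ≡ 4 (mod 8)`),
  `4 ≤ f`, `2f + 4 ≤ |ι|`, one common sign `δ` — OR nega type III — no fixed row or column, `d (π i) = −d i`, `e (κ j) = −e j`.
  (`involution_typeI_eight_dvd`, `no_involution_typeII`, `no_fpf_involution_pos` of gen 13.)
* **`hadamard4q_involution_census`**: the same for `|ι| = 4q`, `q ≡ 3 (mod 4)` — verbatim for the open orders `668, 716, 892`.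
Ours; no `sorry`.
-/

namespace Summit.Ventures.DiscreteObjects.Hadamard

open Finset BigOperators Matrix

open Literature.Combinatorics.Designs.GoethalsSeidel (IsHadamardMatrix)

variable {ι : Type*} [Fintype ι] [DecidableEq ι]

variable {H : Matrix ι ι ℤ} {π κ : Equiv.Perm ι} {d e : ι → ℤ}

/-- **Type II shape, general order `n ≡ 4 (mod 8)`.**  No fixed row but a fixed column: exactly four fixed columns whose signs
sum to `0` (gen 12's proof of `involution668_typeII` with `668` replaced by `n ≡ 4 (mod 8)`). -/
theorem involution_typeII_general (hH : IsHadamardMatrix H) (hmod : Fintype.card ι % 8 = 4) (haut : IsSignedAut H π κ d e)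
    (hπinv : ∀ i, π (π i) = i) (hκinv : ∀ j, κ (κ j) = j) (hfr : ∀ i, π i ≠ i) (hfc : ∃ j, κ j = j) :
    (univ.filter fun j => κ j = j).card = 4 ∧ ∑ j ∈ univ.filter (fun j => κ j = j), e j = 0 := by
  have hcard : (Fintype.card ι : ℤ) ≠ 0 := by
    have : Fintype.card ι ≠ 0 := by omega
    exact_mod_cast this
  have hd := haut.1
  have he := haut.2.1
  have hA := haut.2.2
  obtain ⟨c₀, hc₀⟩ := hfc
  have hS : ∑ j ∈ univ.filter (fun j => κ j = j), e j = 0 := by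
    rw [← signedAut_trace hH hcard haut]
    have : (univ.filter fun i => π i = i) = ∅ := by
      rw [Finset.filter_eq_empty_iff]; intro i _; exact hfr i
    rw [this, Finset.sum_empty]
  refine ⟨?_, hS⟩
  have hdinv : ∀ i, d (π i) = d i := by
    intro i
    have h := signedAut_sq_sign hH.1 haut hπinv hκinv i c₀
    rw [hc₀, pm_mul_self (he c₀), mul_one] at h
    exact (pm_eq_of_mul_eq_one (hd i) (hd (π i)) h).symm
  have heinv : ∀ j, e (κ j) = e j := by
    intro j
    have h := signedAut_sq_sign hH.1 haut hπinv hκinv c₀ j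
    rw [hdinv c₀, pm_mul_self (hd c₀), one_mul] at h
    exact (pm_eq_of_mul_eq_one (he j) (he (κ j)) h).symm
  obtain ⟨i₀⟩ : Nonempty ι := ⟨c₀⟩
  have hrow := signedAut_rowPair hH haut (hfr i₀)
  rw [← Finset.sum_filter_add_sum_filter_not univ (fun j => κ j = j)] at hrow
  have hfix : ∑ j ∈ univ.filter (fun j => κ j = j), e j * (H i₀ j * H i₀ (κ j)) = 0 := by
    rw [← hS]
    refine Finset.sum_congr rfl fun j hj => ?_
    have hj' : κ j = j := by simpa using hj
    rw [hj', pm_mul_self (hH.1 i₀ j), mul_one]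
  rw [hfix, zero_add] at hrow
  obtain ⟨m, hm⟩ := sum_moved_eq_card_sub_four_mul κ hκinv (fun j => e j * (H i₀ j * H i₀ (κ j)))
    (fun j _ => by
      rcases he j with h | h <;> rcases hH.1 i₀ j with h1 | h1 <;> rcases hH.1 i₀ (κ j) with h2 | h2 <;> simp [h, h1, h2])
    (fun j _ => by
      show e (κ j) * (H i₀ (κ j) * H i₀ (κ (κ j))) = e j * (H i₀ j * H i₀ (κ j))
      rw [heinv j, hκinv j]; ring)
  have eC : (univ.filter fun j => κ j ≠ j) = univ.filter (fun j => ¬ κ j = j) := rfl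
  rw [eC, hrow] at hm
  have hsplit := Finset.card_filter_add_card_filter_not (s := (univ : Finset ι)) (fun j => κ j = j)
  rw [Finset.card_univ] at hsplit
  have htwo : ∀ s : ℤ, (s = 1 ∨ s = -1) → (univ.filter fun j => κ j = j ∧ e j = s).card ≤ 2 := by
    intro s hs
    by_contra h3
    obtain ⟨j₁, j₂, j₃, hj₁, hj₂, hj₃, h12, h13, h23⟩ := Finset.two_lt_card_iff.mp (not_le.mp h3)
    simp only [Finset.mem_filter, Finset.mem_univ, true_and] at hj₁ hj₂ hj₃
    have key := card_eq_four_mul_of_three_orth (univ : Finset ι) (fun i => H i j₁) (fun i => H i j₂) (fun i => H i j₃)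
      (fun i _ => hH.1 i j₁) (fun i _ => hH.1 i j₂) (fun i _ => hH.1 i j₃)
      (hadamard_col_orth H hH hcard h12) (hadamard_col_orth H hH hcard h13) (hadamard_col_orth H hH hcard h23)
    rw [Finset.card_univ] at key
    have hcol : ∀ {j}, κ j = j → e j = s → ∀ i, H (π i) j = d i * s * H i j := by
      intro j hj hs' i
      have h := hA i j
      rw [hj, hs'] at h
      exact h
    have hπ2 : π ^ 2 = 1 := by ext x; simp [pow_two, hπinv x]
    have hAdvd : 2 ∣ (univ.filter fun i => H i j₁ = H i j₂ ∧ H i j₁ = H i j₃).card := by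
      apply dvd_card_of_free π (by norm_num) hπ2 _ _ le_rfl
      · intro y hy
        simp only [Finset.mem_filter, Finset.mem_univ, true_and] at hy ⊢
        rw [hcol hj₁.1 hj₁.2, hcol hj₂.1 hj₂.2, hcol hj₃.1 hj₃.2]
        exact ⟨by rw [hy.1], by rw [hy.2]⟩
      · intro y _ k hk0 hk2
        have : k = 1 := by omega
        subst this
        simpa using hfr y
    obtain ⟨a, ha⟩ := hAdvd
    rw [ha] at key
    omega
  have hle : (univ.filter fun j => κ j = j).card ≤ 4 := by
    rw [card_filter_split (fun j => κ j = j) (fun j => e j = 1)]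
    have h1 := htwo 1 (Or.inl rfl)
    have h2 := htwo (-1) (Or.inr rfl)
    have e2 : (univ.filter fun j => κ j = j ∧ ¬ e j = 1) = univ.filter (fun j => κ j = j ∧ e j = -1) := by
      ext j
      simp only [Finset.mem_filter, Finset.mem_univ, true_and]
      constructor
      · rintro ⟨h, h'⟩
        rcases he j with h'' | h''
        · exact absurd h'' h'
        · exact ⟨h, h''⟩
      · rintro ⟨h, h'⟩
        exact ⟨h, by rw [h']; norm_num⟩
    rw [e2]
    omega
  have hpos : 0 < (univ.filter fun j => κ j = j).card :=
    Finset.card_pos.mpr ⟨c₀, by simp [hc₀]⟩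
  omega

/-- **Type I shape, general order `n ≡ 4 (mod 8)`.**  A fixed row and a fixed column: all fixed rows and columns carry one
common sign `δ`, `#Fix π = #Fix κ = f`, `f` even, `2f ≤ n` (given `π ≠ 1`). -/
theorem involution_typeI_general (hH : IsHadamardMatrix H) (hmod : Fintype.card ι % 8 = 4) (haut : IsSignedAut H π κ d e)
    (hπinv : ∀ i, π (π i) = i) (hr : ∃ i, π i = i) (hc : ∃ j, κ j = j) (hne : π ≠ 1) :
    (univ.filter fun i => π i = i).card = (univ.filter fun j => κ j = j).card ∧
    (∃ δ : ℤ, (δ = 1 ∨ δ = -1) ∧ (∀ i, π i = i → d i = δ) ∧ (∀ j, κ j = j → e j = δ)) ∧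
    2 ∣ (univ.filter fun i => π i = i).card ∧ 2 * (univ.filter fun i => π i = i).card ≤ Fintype.card ι := by
  have hcard : (Fintype.card ι : ℤ) ≠ 0 := by
    have : Fintype.card ι ≠ 0 := by omega
    exact_mod_cast this
  have hd := haut.1
  have he := haut.2.1
  obtain ⟨r₀, hr₀⟩ := hr
  obtain ⟨c₀, hc₀⟩ := hc
  have heδ : ∀ j, κ j = j → e j = d r₀ := fun j hj => (signedAut_fixed_sign hH.1 haut hr₀ hj).symm
  have hdδ : ∀ i, π i = i → d i = d r₀ := by
    intro i hi; rw [signedAut_fixed_sign hH.1 haut hi hc₀, heδ c₀ hc₀]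
  have hδ : d r₀ = 1 ∨ d r₀ = -1 := hd r₀
  have htr := signedAut_trace hH hcard haut
  rw [Finset.sum_congr rfl fun i hi => hdδ i (by simpa using hi), Finset.sum_congr rfl fun j hj => heδ j (by simpa using hj),
    Finset.sum_const, Finset.sum_const, nsmul_eq_mul, nsmul_eq_mul] at htr
  have hδ0 : d r₀ ≠ 0 := pm_ne_zero hδ
  have hfeq : ((univ.filter fun i => π i = i).card : ℤ) = ((univ.filter fun j => κ j = j).card : ℤ) :=
    mul_right_cancel₀ hδ0 htr
  have hfeq' : (univ.filter fun i => π i = i).card = (univ.filter fun j => κ j = j).card := by exact_mod_cast hfeq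
  have hsplitR := Finset.card_filter_add_card_filter_not (s := (univ : Finset ι)) (fun i => π i = i)
  rw [Finset.card_univ] at hsplitR
  have h2R := two_dvd_card_moved π hπinv
  have eR : (univ.filter fun i => π i ≠ i) = univ.filter (fun i => ¬ π i = i) := rfl
  rw [eR] at h2R
  obtain ⟨b, hb⟩ := h2R
  have h2n : 2 ∣ Fintype.card ι := ⟨Fintype.card ι / 2, by omega⟩
  refine ⟨hfeq', ⟨d r₀, hδ, hdδ, heδ⟩, ?_, ?_⟩
  · obtain ⟨a, ha⟩ := h2n
    exact ⟨a - b, by omega⟩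
  · obtain ⟨i₀, hi₀⟩ : ∃ i, π i ≠ i := by
      by_contra h
      exact hne (Equiv.ext fun i => not_not.mp (not_exists.mp h i))
    have hrow := signedAut_rowPair hH haut hi₀
    rw [← Finset.sum_filter_add_sum_filter_not univ (fun j => κ j = j)] at hrow
    have hfix : ∑ j ∈ univ.filter (fun j => κ j = j), e j * (H i₀ j * H i₀ (κ j))
        = d r₀ * ((univ.filter fun j => κ j = j).card : ℤ) := by
      have e1 : ∑ j ∈ univ.filter (fun j => κ j = j), e j * (H i₀ j * H i₀ (κ j))
          = ∑ j ∈ univ.filter (fun j => κ j = j), d r₀ := by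
        refine Finset.sum_congr rfl fun j hj => ?_
        have hj' : κ j = j := by simpa using hj
        rw [hj', pm_mul_self (hH.1 i₀ j), mul_one, heδ j hj']
      rw [e1, Finset.sum_const, nsmul_eq_mul, mul_comm]
    rw [hfix] at hrow
    have hbound := abs_sum_pm_le_card (univ.filter fun j => ¬ κ j = j) (fun j => e j * (H i₀ j * H i₀ (κ j)))
      (fun j _ => by
        rcases he j with h | h <;> rcases hH.1 i₀ j with h1 | h1 <;> rcases hH.1 i₀ (κ j) with h2 | h2 <;> simp [h, h1, h2])
    have hsplit := Finset.card_filter_add_card_filter_not (s := (univ : Finset ι)) (fun j => κ j = j)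
    rw [Finset.card_univ] at hsplit
    have hM : ∑ j ∈ univ.filter (fun j => ¬ κ j = j), e j * (H i₀ j * H i₀ (κ j))
        = -(d r₀ * ((univ.filter fun j => κ j = j).card : ℤ)) := by linarith
    rw [hM, abs_neg, abs_mul] at hbound
    have habs : |d r₀| = 1 := by rcases hδ with h | h <;> simp [h]
    rw [habs, one_mul, Nat.abs_cast] at hbound
    have h1 : ((univ.filter fun j => κ j = j).card : ℤ) ≤ ((univ.filter fun j => ¬ κ j = j).card : ℤ) := hbound
    omega

/-- **UNIFORM INVOLUTION CENSUS.**  Let `H` be a Hadamard matrix of order `n ≡ 4 (mod 8)` with `n` not a sum of two squares, and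
`(π, κ, d, e)` a signed-permutation automorphism with `π² = κ² = 1`, `(π, κ) ≠ (1, 1)`.  Then `π ≠ 1`, `κ ≠ 1`, and EITHER
(type I) `#Fix π = #Fix κ = f` with `8 ∣ n − f` (so `f ≡ 4 (mod 8)`), `4 ≤ f`, `2f + 4 ≤ n`, one common sign on all fixed rows and
columns, OR (nega type III) no fixed row, no fixed column, `d (π i) = −d i` and `e (κ j) = −e j` for all `i, j`. -/
theorem hadamard_involution_census_uniform (hH : IsHadamardMatrix H) (hmod : Fintype.card ι % 8 = 4)
    (hns : ¬ ∃ x y : ℕ, Fintype.card ι = x ^ 2 + y ^ 2)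
    (π κ : Equiv.Perm ι) (d e : ι → ℤ) (haut : IsSignedAut H π κ d e)
    (hπ : π ^ 2 = 1) (hκ : κ ^ 2 = 1) (hne : π ≠ 1 ∨ κ ≠ 1) :
    π ≠ 1 ∧ κ ≠ 1 ∧
    (((univ.filter fun i => π i = i).card = (univ.filter fun j => κ j = j).card ∧
        8 ∣ Fintype.card ι - (univ.filter fun i => π i = i).card ∧ 4 ≤ (univ.filter fun i => π i = i).card ∧
        2 * (univ.filter fun i => π i = i).card + 4 ≤ Fintype.card ι ∧
        ∃ δ : ℤ, (δ = 1 ∨ δ = -1) ∧ (∀ i, π i = i → d i = δ) ∧ (∀ j, κ j = j → e j = δ)) ∨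
     ((univ.filter fun i => π i = i).card = 0 ∧ (univ.filter fun j => κ j = j).card = 0 ∧
        (∀ i, d (π i) = -d i) ∧ (∀ j, e (κ j) = -e j))) := by
  have hcard : (Fintype.card ι : ℤ) ≠ 0 := by
    have : Fintype.card ι ≠ 0 := by omega
    exact_mod_cast this
  have hne4 : Fintype.card ι ≠ 4 := by
    intro h4; exact hns ⟨2, 0, by rw [h4]; norm_num⟩
  have hd := haut.1
  have he := haut.2.1
  have hπinv : ∀ i, π (π i) = i := fun i => by
    have := congrArg (fun σ : Equiv.Perm ι => σ i) hπ; simpa [pow_two] using this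
  have hκinv : ∀ j, κ (κ j) = j := fun j => by
    have := congrArg (fun σ : Equiv.Perm ι => σ j) hκ; simpa [pow_two] using this
  have hπ1 : π ≠ 1 := by
    intro h1; rw [h1] at haut
    have := signedAut_snd_eq_one_of_fst_eq_one hH hmod hne4 haut
    rcases hne with h | h
    · exact h h1
    · exact h this
  have hκ1 : κ ≠ 1 := by
    intro h1; rw [h1] at haut
    exact hπ1 (signedAut_fst_eq_one_of_snd_eq_one hH hmod hne4 haut)
  refine ⟨hπ1, hκ1, ?_⟩
  have hautT : IsSignedAut Hᵀ κ π e d := isSignedAut_transpose haut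
  have hHT : IsHadamardMatrix Hᵀ := isHadamard_transpose hH hcard
  have hmodT : Fintype.card ι % 8 = 4 := hmod
  by_cases hr : ∃ i, π i = i
  · by_cases hc : ∃ j, κ j = j
    · -- type I
      left
      obtain ⟨h1, h2, -, h4⟩ := involution_typeI_general hH hmod haut hπinv hr hc hπ1
      have h8 := involution_typeI_eight_dvd hH hns haut hπinv hκinv hr hc
      have hsplitR := Finset.card_filter_add_card_filter_not (s := (univ : Finset ι)) (fun i => π i = i)
      rw [Finset.card_univ] at hsplitR
      have eR : (univ.filter fun i => π i ≠ i) = univ.filter (fun i => ¬ π i = i) := rfl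
      rw [eR] at h8
      obtain ⟨r₀, hr₀⟩ := hr
      have hpos : 0 < (univ.filter fun i => π i = i).card := Finset.card_pos.mpr ⟨r₀, by simp [hr₀]⟩
      refine ⟨h1, ?_, ?_, ?_, h2⟩
      · obtain ⟨a, ha⟩ := h8
        exact ⟨a, by omega⟩
      · omega
      · omega
    · -- (f, 0): the transposed type II — excluded
      exfalso
      have hfc : ∀ j, κ j ≠ j := fun j hj => hc ⟨j, hj⟩
      obtain ⟨h4, hs⟩ := involution_typeII_general hHT hmodT hautT hκinv hπinv hfc hr
      have h0 : (univ.filter fun j => κ j = j).card = 0 := by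
        rw [Finset.card_eq_zero, Finset.filter_eq_empty_iff]; intro j _; exact hfc j
      exact no_involution_typeII hHT hmodT hns hautT hκinv hπinv h0 h4 hs
  · have hfr : ∀ i, π i ≠ i := fun i hi => hr ⟨i, hi⟩
    have h0 : (univ.filter fun i => π i = i).card = 0 := by
      rw [Finset.card_eq_zero, Finset.filter_eq_empty_iff]; intro i _; exact hfr i
    by_cases hc : ∃ j, κ j = j
    · -- (0, f): type II — excluded
      exfalso
      obtain ⟨h4, hs⟩ := involution_typeII_general hH hmod haut hπinv hκinv hfr hc
      exact no_involution_typeII hH hmod hns haut hπinv hκinv h0 h4 hs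
    · -- type III: nega
      right
      have hfc : ∀ j, κ j ≠ j := fun j hj => hc ⟨j, hj⟩
      have h0' : (univ.filter fun j => κ j = j).card = 0 := by
        rw [Finset.card_eq_zero, Finset.filter_eq_empty_iff]; intro j _; exact hfc j
      -- ε is constant; ε = +1 is excluded by `no_fpf_involution_pos`
      obtain ⟨i₀⟩ : Nonempty ι := Fintype.card_pos_iff.mp (by omega)
      have hsq := signedAut_sq_sign hH.1 haut hπinv hκinv
      by_cases hε0 : d (π i₀) = d i₀
      · exfalso
        have hcol : ∀ j, e (κ j) = e j := by
          intro j
          have h := hsq i₀ j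
          rw [hε0, pm_mul_self (hd i₀), one_mul] at h
          exact (pm_eq_of_mul_eq_one (he j) (he (κ j)) h).symm
        have hrow : ∀ i, d (π i) = d i := by
          intro i
          have h := hsq i i₀
          rw [hcol i₀, pm_mul_self (he i₀), mul_one] at h
          exact (pm_eq_of_mul_eq_one (hd i) (hd (π i)) h).symm
        exact no_fpf_involution_pos hH hmod hns haut hπinv hκinv hfr hfc hrow
      · have hneg0 : d (π i₀) = -d i₀ := by
          rcases hd (π i₀) with h1 | h1 <;> rcases hd i₀ with h2 | h2 <;> simp_all
        have hprod0 : d i₀ * d (π i₀) = -1 := by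
          rw [hneg0]; have := pm_mul_self (hd i₀); linarith [this, sq_nonneg (d i₀)]
        have hcol : ∀ j, e (κ j) = -e j := by
          intro j
          have h := hsq i₀ j
          rw [hprod0] at h
          have h2 : e j * e (κ j) = -1 := by linarith
          rcases he j with h3 | h3 <;> rcases he (κ j) with h4 | h4 <;> simp_all
        have hrow : ∀ i, d (π i) = -d i := by
          intro i
          have h := hsq i i₀
          have h2 : e i₀ * e (κ i₀) = -1 := by
            rw [hcol i₀]; have := pm_mul_self (he i₀); linarith
          rw [h2] at h
          have h3 : d i * d (π i) = -1 := by linarith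
          rcases hd i with h4 | h4 <;> rcases hd (π i) with h5 | h5 <;> simp_all
        exact ⟨h0, h0', hrow, hcol⟩

/-- **H(4q), `q ≡ 3 (mod 4)`: the involution census** — verbatim `hadamard_involution_census_uniform` (`4q ≡ 4 (mod 8)` and
`4q` is not a sum of two squares).  Applies to the open orders `668, 716, 892` (`q = 167, 179, 223`). -/
theorem hadamard4q_involution_census {q : ℕ} (hq4 : q % 4 = 3) (hH : IsHadamardMatrix H) (hι : Fintype.card ι = 4 * q)
    (π κ : Equiv.Perm ι) (d e : ι → ℤ) (haut : IsSignedAut H π κ d e)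
    (hπ : π ^ 2 = 1) (hκ : κ ^ 2 = 1) (hne : π ≠ 1 ∨ κ ≠ 1) :
    π ≠ 1 ∧ κ ≠ 1 ∧
    (((univ.filter fun i => π i = i).card = (univ.filter fun j => κ j = j).card ∧
        8 ∣ Fintype.card ι - (univ.filter fun i => π i = i).card ∧ 4 ≤ (univ.filter fun i => π i = i).card ∧
        2 * (univ.filter fun i => π i = i).card + 4 ≤ Fintype.card ι ∧
        ∃ δ : ℤ, (δ = 1 ∨ δ = -1) ∧ (∀ i, π i = i → d i = δ) ∧ (∀ j, κ j = j → e j = δ)) ∨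
     ((univ.filter fun i => π i = i).card = 0 ∧ (univ.filter fun j => κ j = j).card = 0 ∧
        (∀ i, d (π i) = -d i) ∧ (∀ j, e (κ j) = -e j))) := by
  have hmod : Fintype.card ι % 8 = 4 := by rw [hι]; omega
  have hns : ¬ ∃ x y : ℕ, Fintype.card ι = x ^ 2 + y ^ 2 := by rw [hι]; exact not_sq_add_sq_four_mul_nat hq4
  exact hadamard_involution_census_uniform hH hmod hns π κ d e haut hπ hκ hne

end Summit.Ventures.DiscreteObjects.Hadamard
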